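import Mathlib
import HarnessLib
import Literature.Analysis.FluidPDE.NSBoundedMildAnalytic
import Literature.Analysis.FluidPDE.KNSSTypeIRateLiouvilleMild
import Literature.Analysis.FluidPDE.KNSSTypeIRateMildProofs
import Literature.Analysis.FluidPDE.TypeIAncientMild
import Literature.Analysis.FluidPDE.ClassicalSolutionRescale
import Literature.Analysis.FluidPDE.BlowupAncientSolution
import Literature.Analysis.FluidPDE.TaoEnstrophyLocalisation

/-!
# Bounded continuous Oseen-ancient fields are jointly real-analytic — crux
# stmt-NavierStokesRegularity-11739 (`IsobarTomography.TubeAlternative`), line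
# `analytic-propagation-local-patch`, stub `stub_oseenAncientAnalytic`

A field `w : ℝ → ℝ³ → ℝ³`, continuous and bounded on the open slab `(-∞,0) × ℝ³` and satisfying
the Oseen integral identity `w(t) = e^{(t-s)Δ} w(s) − B¹_s(w,w)(t)` pointwise for all `s < t < 0`
(`B¹_s = oseenDuhamel 1 s`, `e^{τΔ} = UnboundedOperators.heatExtension · τ`), is jointly
real-analytic on the slab: `AnalyticOnNhd ℝ (uncurry w) (Iio 0 ×ˢ univ)`.

Proof (the covering argument of Lemarié-Rieusset 2016, Thm. 9.12, PDF p. 263, in the tree's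
rendering; template `Literature.Analysis.FluidPDE.exists_analytic_representative_of_mild_L3`,
here in the simpler setting of an everywhere bounded, continuous field). Fix `(t, x)` with `t < 0`,
let `M' = max M 1 > 0` (`M` the bound) and `h = ε/M'²` the lifespan of the PROVED local fact
`lemarieRieusset2016_local_analyticity_holds` (`ν = 1`), and restart at `s = t − h/2 < t < s + h`:
the datum `w(s)` is continuous, hence measurable, and essentially bounded by `M'`, so the local
fact provides a field `vl`, jointly real-analytic on `(s, s + h) × ℝ³ ∋ (t, x)`, solving
`vl(τ) = e^{1·(τ-s)Δ} w(s) − B¹_s(vl,vl)(τ)` pointwise there with `‖vl‖ ≤ C M'`. On the window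
`(s, T₂)`, `T₂ = min(s + h, 0) > t`, both `w` (by hypothesis, `τ < 0`) and `vl` are pointwise
bounded, jointly measurable (continuous) solutions of the same integral equation, so they agree
a.e. on every slice (`oseenMild_bounded_unique`, PROVED, KNSS 2009 §4), hence everywhere on every
slice (both slices are continuous; Mathlib `Continuous.ae_eq_iff_eq`). Thus `uncurry w = uncurry vl`
on the open neighbourhood `(s, T₂) × ℝ³` of `(t, x)`, and `uncurry w` is analytic at `(t, x)`
(`AnalyticAt.congr`). No identity theorem is used here.
-/

-- the problem directory repeats the summit name (`NavierStokesRegularity/NavierStokesRegularity`,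
-- D-0017), which core's `dupNamespace` linter reports on every declaration of this namespace
set_option linter.dupNamespace false

noncomputable section

namespace Summit.NavierStokesRegularity.NavierStokesRegularity.Theorems.TubeAlternative.AnalyticPropagation

open Set Filter Topology Function MeasureTheory
open Literature.Analysis.FluidPDE
open scoped ENNReal

/-- Physical space `ℝ³` (file-local notation; the registered stub signature is stated with it). -/
local notation "E3" => EuclideanSpace ℝ (Fin 3)

/-- Slices `w t`, `t < 0`, of a field `w` with `uncurry w` continuous on the open slab
`(-∞,0) × ℝ³` are continuous (composition with the continuous embedding `x ↦ (t, x)`). -/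
theorem continuous_slice_of_continuousOn_slab {w : ℝ → E3 → E3}
    (hw : ContinuousOn (uncurry w) (Set.Iio 0 ×ˢ Set.univ)) {t : ℝ} (ht : t < 0) :
    Continuous (w t) :=
  hw.comp_continuous (continuous_const.prodMk continuous_id) fun x => ⟨ht, mem_univ x⟩

/-- **Stub `stub_oseenAncientAnalytic` (line `analytic-propagation-local-patch` of crux
`IsobarTomography.TubeAlternative`).** A field `w`, continuous and bounded on the open slab
`(-∞,0) × ℝ³` and satisfying the Oseen integral identity
`w t x = e^{(t-s)Δ}(w s) x − oseenDuhamel 1 s w w t x` for all `s < t < 0` and all `x`, has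
`uncurry w` jointly real-analytic on `Iio 0 ×ˢ univ`. Source: Lemarié-Rieusset 2016, Thm. 9.12
(local analyticity of Oseen's scheme, PROVED in the tree as
`lemarieRieusset2016_local_analyticity_holds`), restarted at `s = t − h/2` for every `t < 0`, and
uniqueness of bounded solutions of the Oseen integral equation (`oseenMild_bounded_unique`,
KNSS 2009 §4), upgraded from a.e. to everywhere by continuity of the slices. -/
theorem stub_oseenAncientAnalytic :
    ∀ (w : ℝ → E3 → E3), ContinuousOn (uncurry w) (Set.Iio 0 ×ˢ Set.univ) →
    (∃ M : ℝ, ∀ t < 0, ∀ x : E3, ‖w t x‖ ≤ M) →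
    (∀ s t : ℝ, s < t → t < 0 → ∀ x : E3,
      w t x = Literature.Analysis.UnboundedOperators.heatExtension (w s) (t - s) x -
        oseenDuhamel 1 s w w t x) →
    AnalyticOnNhd ℝ (uncurry w) (Set.Iio 0 ×ˢ Set.univ) := by
  intro w hcont hbd hos
  obtain ⟨ε, hε, C, -, hLoc⟩ := lemarieRieusset2016_local_analyticity_holds
  obtain ⟨M, hM⟩ := hbd
  -- a positive bound `M' = max M 1`
  set M' : ℝ := max M 1
  have hM'0 : 0 < M' := one_pos.trans_le (le_max_right _ _)
  have hMM' : M ≤ M' := le_max_left _ _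
  -- the lifespan of the local fact at `ν = 1`
  have hh0 : 0 < ε * 1 / M' ^ 2 := by positivity
  set h : ℝ := ε * 1 / M' ^ 2
  intro z hz
  obtain ⟨ht, -⟩ := mem_prod.1 hz
  have ht0 : z.1 < 0 := ht
  -- restart time `s = t - h/2` and window end `T₂ = min (s + h) 0`
  obtain ⟨s, hst, htsh⟩ : ∃ s : ℝ, s < z.1 ∧ z.1 < s + h :=
    ⟨z.1 - h / 2, by linarith, by linarith⟩
  have hs0 : s < 0 := hst.trans ht0
  obtain ⟨T₂, htT₂, hT₂h, hT₂0⟩ : ∃ T₂ : ℝ, z.1 < T₂ ∧ T₂ ≤ s + h ∧ T₂ ≤ 0 :=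
    ⟨min (s + h) 0, lt_min htsh ht0, min_le_left _ _, min_le_right _ _⟩
  -- the datum `w s`: continuous, hence measurable, essentially bounded by `M'`
  have hws : Continuous (w s) := continuous_slice_of_continuousOn_slab hcont hs0
  have ha : AEStronglyMeasurable (w s) volume := hws.aestronglyMeasurable
  have haM : eLpNorm (w s) ∞ volume ≤ ENNReal.ofReal M' := by
    rw [eLpNorm_exponent_top]
    exact eLpNormEssSup_le_of_ae_bound (Eventually.of_forall fun x => (hM s hs0 x).trans hMM')
  -- the local analytic Oseen solution from `w s` at time `s`
  obtain ⟨vl, hvl_an, hvl_eq, hvl_bd⟩ := hLoc one_pos s hM'0 ha haM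
  -- uniqueness of bounded solutions on `(s, T₂)`, common bound `M'' = max M' (C M')`
  set M'' : ℝ := max M' (C * M')
  have hM''0 : 0 ≤ M'' := hM'0.le.trans (le_max_left _ _)
  have hsub : Ioo s T₂ ×ˢ (univ : Set E3) ⊆ Iio 0 ×ˢ univ :=
    prod_mono (fun τ hτ => hτ.2.trans_le hT₂0) Subset.rfl
  have hum : AEStronglyMeasurable (uncurry w) (volume.restrict (Ioo s T₂ ×ˢ univ)) :=
    (hcont.mono hsub).aestronglyMeasurable (measurableSet_Ioo.prod MeasurableSet.univ)
  have hvm : AEStronglyMeasurable (uncurry vl) (volume.restrict (Ioo s T₂ ×ˢ univ)) :=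
    (hvl_an.continuousOn.mono (prod_mono (Ioo_subset_Ioo_right hT₂h) Subset.rfl)).aestronglyMeasurable
      (measurableSet_Ioo.prod MeasurableSet.univ)
  have huM : ∀ τ ∈ Ioo s T₂, ∀ y, ‖w τ y‖ ≤ M'' := fun τ hτ y =>
    ((hM τ (hτ.2.trans_le hT₂0) y).trans hMM').trans (le_max_left _ _)
  have hvM : ∀ τ ∈ Ioo s T₂, ∀ y, ‖vl τ y‖ ≤ M'' := fun τ hτ y =>
    (hvl_bd τ ⟨hτ.1, hτ.2.trans_le hT₂h⟩ y).trans (le_max_right _ _)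
  have hu : ∀ τ ∈ Ioo s T₂, w τ =ᵐ[volume] fun x =>
      Literature.Analysis.UnboundedOperators.heatExtension (w s) (τ - s) x -
        oseenDuhamel 1 s w w τ x :=
    fun τ hτ => Eventually.of_forall fun x => hos s τ hτ.1 (hτ.2.trans_le hT₂0) x
  have hv : ∀ τ ∈ Ioo s T₂, vl τ =ᵐ[volume] fun x =>
      Literature.Analysis.UnboundedOperators.heatExtension (w s) (τ - s) x -
        oseenDuhamel 1 s vl vl τ x := by
    intro τ hτ
    refine Eventually.of_forall fun x => ?_
    have e := hvl_eq τ ⟨hτ.1, hτ.2.trans_le hT₂h⟩ x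
    rwa [one_mul] at e
  have hae : ∀ τ ∈ Ioo s T₂, w τ =ᵐ[volume] vl τ :=
    oseenMild_bounded_unique (U := fun τ x =>
      Literature.Analysis.UnboundedOperators.heatExtension (w s) (τ - s) x)
      one_pos hM''0 hum hvm huM hvM hu hv
  -- a.e. equal continuous slices coincide
  have heq : ∀ τ ∈ Ioo s T₂, w τ = vl τ := fun τ hτ =>
    ((continuous_slice_of_continuousOn_slab hcont (hτ.2.trans_le hT₂0)).ae_eq_iff_eq volume
      (continuousOn_univ.1
        (analyticOnNhd_slice hvl_an ⟨hτ.1, hτ.2.trans_le hT₂h⟩).continuousOn)).1 (hae τ hτ)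
  -- `uncurry w = uncurry vl` near `z`, and `uncurry vl` is analytic at `z`
  have hzmem : z ∈ Ioo s (s + h) ×ˢ (univ : Set E3) := mem_prod.2 ⟨⟨hst, htsh⟩, mem_univ _⟩
  have hzmem' : z ∈ Ioo s T₂ ×ˢ (univ : Set E3) := mem_prod.2 ⟨⟨hst, htT₂⟩, mem_univ _⟩
  refine (hvl_an z hzmem).congr ?_
  filter_upwards [(isOpen_Ioo.prod isOpen_univ).mem_nhds hzmem'] with y hy
  obtain ⟨hy1, -⟩ := mem_prod.1 hy
  change vl y.1 y.2 = w y.1 y.2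
  rw [heq y.1 hy1]

end Summit.NavierStokesRegularity.NavierStokesRegularity.Theorems.TubeAlternative.AnalyticPropagation

end

/-! ## Appendix (stub `stub_peakZoomPatch` of the same line): scale covariance of the isobaric
action, and the sup-normalisation of a Type-I ancient mild field with an isobaric patch

Two bookkeeping steps of the vorticity-scale zoom of the line (file
`IsobarTomographyTubeAlternativeStubPeakZoomPatch.lean`), both elementary consequences of the
parabolic scaling `Φ(s, y) = (t₀ + β s, x₀ + γ y)` (tree: `stPull`, `stAffine`,
`IsClassicalNSSolutionOn.stRescale`, `oseen_smul_stPull`, `setIntegral_preimage_comp_stAffine`). -/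

namespace Summit.NavierStokesRegularity.NavierStokesRegularity.Theorems.TubeAlternative.AnalyticPropagation

open Set Filter Topology Function MeasureTheory Metric
open scoped RealInnerProductSpace
open Literature.Analysis Literature.Analysis.FluidPDE

/-! ### The isobaric action is scale-free -/

/-- **The isobaric action is invariant under the viscosity-normalising zoom.** For a classical
pair `(u, p)` on `[0, T)` with viscosity `ν`, a centre `x₀`, a scale `c > 0` and a time `t ≤ T`
with `0 ≤ t − c²ν`, the zoomed pair `w = c u ∘ Φ`, `q = c² p ∘ Φ`, `Φ(s, y) = (T + c²ν s, x₀ + cν y)`,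
satisfies `∫_{(s₁−1, s₁) × B(0,1)} |⟪curl w, ∇q⟫| = ν⁻² ∫_{(t − c²ν, t) × B(x₀, cν)} |⟪curl u, ∇p⟫|`,
`s₁ = (t − T)/(c²ν)`: pointwise `⟪curl w, ∇q⟫ = c⁵ν² ⟪curl u, ∇p⟫ ∘ Φ` (chain rule), and `Φ`
scales Lebesgue measure by `c²ν · (cν)³` (`setIntegral_preimage_comp_stAffine`). [folklore] -/
theorem zoom_action_eq {ν T c t : ℝ} (hν : 0 < ν) (hc : 0 < c) {u : ℝ → (EuclideanSpace ℝ (Fin 3)) → (EuclideanSpace ℝ (Fin 3))} {p : ℝ → (EuclideanSpace ℝ (Fin 3)) → ℝ}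
    (hsol : IsClassicalNSSolutionOn (Ico 0 T) ν 0 u p) (x₀ : (EuclideanSpace ℝ (Fin 3))) (ht : t ≤ T)
    (ht0 : 0 ≤ t - c ^ 2 * ν) :
    ∫ z in Ioo ((t - T) / (c ^ 2 * ν) - 1) ((t - T) / (c ^ 2 * ν)) ×ˢ ball (0 : (EuclideanSpace ℝ (Fin 3))) 1,
        |⟪curl (((c * 1) • stPull (c ^ 2 * ν) (c * ν) T x₀ u) z.1) z.2,
          gradient (((c * 1) ^ 2 • stPull (c ^ 2 * ν) (c * ν) T x₀ p) z.1) z.2⟫| =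
      ν⁻¹ ^ 2 * ∫ z in Ioo (t - c ^ 2 * ν) t ×ˢ ball x₀ (c * ν),
        |⟪curl (u z.1) z.2, gradient (p z.1) z.2⟫| := by
  have hβ : 0 < c ^ 2 * ν := by positivity
  have hγ : 0 < c * ν := by positivity
  set S : Set (ℝ × (EuclideanSpace ℝ (Fin 3))) := Ioo (t - c ^ 2 * ν) t ×ˢ ball x₀ (c * ν) with hS
  set G : ℝ × (EuclideanSpace ℝ (Fin 3)) → ℝ := fun z => |⟪curl (u z.1) z.2, gradient (p z.1) z.2⟫| with hG
  -- the preimage of the physical cylinder is the unit cylinder below `s₁`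
  have hpre : stAffine (c ^ 2 * ν) (c * ν) T x₀ ⁻¹' S =
      Ioo ((t - T) / (c ^ 2 * ν) - 1) ((t - T) / (c ^ 2 * ν)) ×ˢ ball (0 : (EuclideanSpace ℝ (Fin 3))) 1 := by
    rw [hS, stAffine_preimage_cylinder hβ hγ, sub_self, smul_zero, div_self hγ.ne']
    congr 2
    field_simp
    ring
  -- the pointwise identity on the preimage
  have hpt : ∀ z ∈ stAffine (c ^ 2 * ν) (c * ν) T x₀ ⁻¹' S,
      |⟪curl (((c * 1) • stPull (c ^ 2 * ν) (c * ν) T x₀ u) z.1) z.2,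
        gradient (((c * 1) ^ 2 • stPull (c ^ 2 * ν) (c * ν) T x₀ p) z.1) z.2⟫| =
      (c ^ 5 * ν ^ 2) * G (stAffine (c ^ 2 * ν) (c * ν) T x₀ z) := by
    rintro ⟨s, y⟩ hz
    obtain ⟨⟨h1, h2⟩, -⟩ := hz
    rw [stAffine_fst] at h1 h2
    have hτ : T + c ^ 2 * ν * s ∈ Ico 0 T := ⟨by linarith, by
      rcases ht.lt_or_eq with hlt | rfl
      · linarith
      · linarith⟩
    have hud : Differentiable ℝ (u (T + c ^ 2 * ν * s)) :=
      (hsol.contDiff_velocity hτ).differentiable (by simp)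
    have hpd : DifferentiableAt ℝ (stPull (c ^ 2 * ν) (c * ν) T x₀ p s) y :=
      differentiable_stPull_slice ((hsol.contDiff_pressure hτ).differentiable (by simp)) y
    have hcurl : curl (((c * 1) • stPull (c ^ 2 * ν) (c * ν) T x₀ u) s) y =
        (c * 1 * (c * ν)) • curl (u (T + c ^ 2 * ν * s)) (x₀ + (c * ν) • y) := by
      rw [curl_eq_curlCLM, curl_eq_curlCLM, show ((c * 1) • stPull (c ^ 2 * ν) (c * ν) T x₀ u) s =
        fun z => (c * 1) • stPull (c ^ 2 * ν) (c * ν) T x₀ u s z from rfl,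
        fderiv_fun_const_smul (differentiable_stPull_slice hud y), fderiv_stPull, smul_smul, map_smul]
    rw [hcurl,
      show ((c * 1) ^ 2 • stPull (c ^ 2 * ν) (c * ν) T x₀ p) s =
        fun z => ((c * 1) ^ 2) • stPull (c ^ 2 * ν) (c * ν) T x₀ p s z from rfl,
      gradient_const_smul hpd, gradient_stPull, smul_smul, inner_smul_left, inner_smul_right,
      hG, stAffine_apply, abs_mul, abs_mul]
    simp only [RCLike.conj_to_real]
    rw [abs_of_pos (by positivity), abs_of_pos (by positivity)]
    ring
  rw [← hpre, setIntegral_congr_fun ((measurableSet_Ioo.prod measurableSet_ball).preimage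
      (measurable_stAffine _ _ _ _)) hpt, integral_const_mul,
    setIntegral_preimage_comp_stAffine hβ hγ T x₀ G S, finrank_euclideanSpace_fin, smul_eq_mul]
  field_simp

/-- **Sup-normalisation of a Type-I ancient mild field with an isobaric patch.** Let `W` be a
Type-I ancient mild field of the Oseen gauge (`IsTypeIAncientMild C W`) with a classical pressure
`q` on `(-∞, 0)`, a slice `s₁ < 0` of non-zero vorticity somewhere, and an open non-empty set
`U₀ ⊆ (-∞, s₁] × ℝ³` on which the isobaric defect `⟪curl W, ∇q⟫` vanishes. Then the time-shifted
parabolic rescaling `v(s, y) = l W(−δ + l²s, l y)`, `δ = −s₁/2`, `l = 1/M`,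
`M = sup_{t < −δ} |W| ∈ (0, C/√δ]`, together with `q' = l² q ∘ Φ`, is a KNSS blow-up limit
(`IsKNSSBlowupLimit`: duality-mild via `isBoundedAncientMildSolution_of_oseen`, smooth, `|v| ≤ 1 = sup`)
with classical pressure on `(-∞, 0)` (`IsClassicalNSSolutionOn.stRescale`), Oseen-ancient
(`oseen_smul_stPull`), not slice-wise constant (the non-zero vorticity survives), and its defect
vanishes on the open set `Φ⁻¹(U₀)` (the defect is scale covariant). Used by stub
`stub_peakZoomPatch` of the same line. [folklore] -/
theorem knssLimit_of_ancientPatch :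
    ∀ (C : ℝ) (W : ℝ → EuclideanSpace ℝ (Fin 3) → EuclideanSpace ℝ (Fin 3))
    (q : ℝ → EuclideanSpace ℝ (Fin 3) → ℝ), Literature.Analysis.FluidPDE.IsTypeIAncientMild C W →
    Literature.Analysis.FluidPDE.IsClassicalNSSolutionOn (Set.Iio 0) 1 0 W q →
    ∀ (s₁ : ℝ), s₁ < 0 →
    (∃ x : EuclideanSpace ℝ (Fin 3), Literature.Analysis.FluidPDE.curl (W s₁) x ≠ 0) →
    ∀ U₀ : Set (ℝ × EuclideanSpace ℝ (Fin 3)), IsOpen U₀ → U₀.Nonempty →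
    U₀ ⊆ Set.Iic s₁ ×ˢ Set.univ →
    (∀ z ∈ U₀, ⟪Literature.Analysis.FluidPDE.curl (W z.1) z.2, gradient (q z.1) z.2⟫ = 0) →
    ∃ (v : ℝ → EuclideanSpace ℝ (Fin 3) → EuclideanSpace ℝ (Fin 3))
      (q' : ℝ → EuclideanSpace ℝ (Fin 3) → ℝ),
      Literature.Analysis.FluidPDE.IsKNSSBlowupLimit v ∧
      Literature.Analysis.FluidPDE.IsClassicalNSSolutionOn (Set.Iio 0) 1 0 v q' ∧
      (∀ s t : ℝ, s < t → t < 0 → ∀ x : EuclideanSpace ℝ (Fin 3),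
        v t x = Literature.Analysis.UnboundedOperators.heatExtension (v s) (t - s) x -
          Literature.Analysis.FluidPDE.oseenDuhamel 1 s v v t x) ∧
      ¬ (∀ t < 0, ∃ b : EuclideanSpace ℝ (Fin 3), v t = fun _ => b) ∧
      ∃ U : Set (ℝ × EuclideanSpace ℝ (Fin 3)), IsOpen U ∧ U.Nonempty ∧
        U ⊆ Set.Iio 0 ×ˢ Set.univ ∧
        ∀ z ∈ U, ⟪Literature.Analysis.FluidPDE.curl (v z.1) z.2, gradient (q' z.1) z.2⟫ = 0 := by
  intro C W q hW hcl s₁ hs₁ hcurl U₀ hU₀o hU₀ne hU₀sub hU₀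
  obtain ⟨x₁, hx₁⟩ := hcurl
  -- ## the shift `δ` and the supremum `M` of `‖W‖` over `t < -δ`
  set δ : ℝ := -s₁ / 2 with hδ
  have hδ0 : 0 < δ := by rw [hδ]; linarith
  have hs₁δ : s₁ < -δ := by rw [hδ]; linarith
  have hC0 : 0 ≤ C := hW.nonneg
  set M : ℝ := ⨆ z : {z : ℝ × (EuclideanSpace ℝ (Fin 3)) // z.1 < -δ}, ‖W z.1.1 z.1.2‖ with hM
  have hbdd : BddAbove (range fun z : {z : ℝ × (EuclideanSpace ℝ (Fin 3)) // z.1 < -δ} => ‖W z.1.1 z.1.2‖) := by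
    refine ⟨C / Real.sqrt δ, ?_⟩
    rintro _ ⟨z, rfl⟩
    refine (hW.norm_le (z.2.trans (neg_neg_of_pos hδ0)) _).trans ?_
    exact div_le_div_of_nonneg_left hC0 (Real.sqrt_pos.2 hδ0)
      (Real.sqrt_le_sqrt (by linarith [z.2]))
  haveI : Nonempty {z : ℝ × (EuclideanSpace ℝ (Fin 3)) // z.1 < -δ} := ⟨⟨(s₁, 0), hs₁δ⟩⟩
  have hWM : ∀ t : ℝ, t < -δ → ∀ x, ‖W t x‖ ≤ M := fun t ht x => le_ciSup hbdd ⟨(t, x), ht⟩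
  -- `M > 0`: otherwise the slice `s₁` vanishes and so does its curl
  have hM0 : 0 < M := by
    by_contra hM0
    push Not at hM0
    have hz : W s₁ = fun _ => 0 := funext fun x =>
      norm_le_zero_iff.1 ((hWM s₁ hs₁δ x).trans hM0)
    exact hx₁ (by rw [hz, curl_eq_curlCLM]; simp)
  -- ## the rescaling `v(s, y) = l W(-δ + l² s, l y)`, `l = 1/M`
  set l : ℝ := M⁻¹ with hl
  have hl0 : 0 < l := inv_pos.2 hM0
  have hlM : l * M = 1 := inv_mul_cancel₀ hM0.ne'
  set v : ℝ → (EuclideanSpace ℝ (Fin 3)) → (EuclideanSpace ℝ (Fin 3)) := l • stPull (l ^ 2) l (-δ) 0 W with hv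
  set q' : ℝ → (EuclideanSpace ℝ (Fin 3)) → ℝ := l ^ 2 • stPull (l ^ 2) l (-δ) 0 q with hq'
  have hv_apply : ∀ s y, v s y = l • W (-δ + l ^ 2 * s) (0 + l • y) := fun s y => rfl
  have htime : ∀ {s : ℝ}, s < 0 → -δ + l ^ 2 * s < -δ := fun hs => by
    have : l ^ 2 * _ < 0 := mul_neg_of_pos_of_neg (pow_pos hl0 2) hs
    linarith
  have htime0 : ∀ {s : ℝ}, s < 0 → -δ + l ^ 2 * s < 0 := fun hs =>
    (htime hs).trans (neg_neg_of_pos hδ0)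
  -- classical on `Iio 0`
  have hclv : IsClassicalNSSolutionOn (Iio 0) 1 0 v q' := by
    have key := hcl.stRescale hl0 hl0 (show l ^ 2 = l * l by ring) (-δ) 0
    have hforce : ((l ^ 2 * l) • stPull (l ^ 2) l (-δ) 0
        (0 : ℝ → (EuclideanSpace ℝ (Fin 3)) → (EuclideanSpace ℝ (Fin 3)))) = 0 := by
      funext s y; simp [stPull]
    rw [show l * 1 / l = 1 by field_simp, hforce] at key
    exact key.mono (fun s hs => htime0 hs) isOpen_Iio.uniqueDiffOn
  -- the Oseen identity
  have hosv : ∀ s t : ℝ, s < t → t < 0 → ∀ x, v t x =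
      UnboundedOperators.heatExtension (v s) (t - s) x - oseenDuhamel 1 s v v t x := by
    intro s t hst ht x
    refine oseen_smul_stPull hl0 (-δ) 0 hst (fun X => hW.mild_eq_heatExtension ?_ (htime0 ht) X) x
    have := mul_lt_mul_of_pos_left hst (pow_pos hl0 2)
    linarith
  -- bounds
  have hle1 : ∀ t < 0, ∀ x, ‖v t x‖ ≤ 1 := fun t ht x => by
    rw [hv_apply, norm_smul, Real.norm_of_nonneg hl0.le, ← hlM]
    exact mul_le_mul_of_nonneg_left (hWM _ (htime ht) _) hl0.le
  have hsup : ∀ ε : ℝ, 0 < ε → ∃ t < 0, ∃ x, 1 - ε < ‖v t x‖ := by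
    intro ε hε
    have hlt : M * (1 - ε) < M := by nlinarith
    obtain ⟨⟨⟨t, x⟩, ht⟩, hlt'⟩ := exists_lt_of_lt_ciSup hlt
    refine ⟨(t + δ) / l ^ 2, div_neg_of_neg_of_pos (by simp only at ht; linarith) (pow_pos hl0 2),
      l⁻¹ • x, ?_⟩
    rw [hv_apply, zero_add, smul_inv_smul₀ hl0.ne', mul_div_cancel₀ _ (pow_pos hl0 2).ne',
      show -δ + (t + δ) = t by ring, norm_smul, Real.norm_of_nonneg hl0.le]
    calc 1 - ε = l * (M * (1 - ε)) := by rw [← mul_assoc, hlM, one_mul]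
      _ < l * ‖W t x‖ := mul_lt_mul_of_pos_left hlt' hl0
  -- the KNSS blow-up limit structure
  have hcont : ContinuousOn (uncurry v) (Iio 0 ×ˢ univ) := hclv.smooth_velocity.continuousOn
  have hknss : IsKNSSBlowupLimit v := by
    refine ⟨?_, fun t ht => (hclv.contDiff_velocity ht).continuous.aestronglyMeasurable,
      hclv.smooth_velocity, hle1, hsup⟩
    refine isBoundedAncientMildSolution_of_oseen one_pos hcont ⟨1, hle1⟩ (fun t ht => ?_)
      (fun s t hst ht x => by rw [one_mul]; exact hosv s t hst ht x)
    exact VectorCalculus.IsDivFree.isWeaklyDivFree_holds (hclv.divFree t ht)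
      ((hclv.contDiff_velocity ht).of_le (by exact_mod_cast le_top))
  -- vorticity of the rescaled field
  have hcurlv : ∀ {s : ℝ}, s < 0 → ∀ y,
      curl (v s) y = (l * l) • curl (W (-δ + l ^ 2 * s)) (0 + l • y) := fun {s} hs y => by
    have hd := differentiable_stPull_slice (β := l ^ 2) (γ := l) (t₀ := -δ) (x₀ := 0)
      ((hW.contDiff_slice (htime0 hs)).differentiable (by simp))
    rw [curl_eq_curlCLM, curl_eq_curlCLM, show v s = fun z => l • stPull (l ^ 2) l (-δ) 0 W s z
      from rfl, fderiv_fun_const_smul (hd y), fderiv_stPull, smul_smul, map_smul]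
  -- not slice-constant: the slice through `s₁` has non-zero vorticity
  have hnc : ¬ (∀ t < 0, ∃ b : (EuclideanSpace ℝ (Fin 3)), v t = fun _ => b) := by
    intro h
    have hs : (s₁ + δ) / l ^ 2 < 0 := div_neg_of_neg_of_pos (by linarith) (pow_pos hl0 2)
    obtain ⟨b, hb⟩ := h _ hs
    have h1 := hcurlv hs (l⁻¹ • x₁)
    rw [hb, zero_add, smul_inv_smul₀ hl0.ne', mul_div_cancel₀ _ (pow_pos hl0 2).ne',
      show -δ + (s₁ + δ) = s₁ by ring, curl_eq_curlCLM] at h1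
    simp only [fderiv_fun_const, Pi.zero_apply, map_zero] at h1
    exact hx₁ ((smul_eq_zero.1 h1.symm).resolve_left (mul_pos hl0 hl0).ne')
  -- the patch
  refine ⟨v, q', hknss, hclv, hosv, hnc, stAffine (l ^ 2) l (-δ) 0 ⁻¹' U₀,
    hU₀o.preimage (continuous_stAffine _ _ _ _), ?_, ?_, ?_⟩
  · obtain ⟨⟨t, x⟩, hz⟩ := hU₀ne
    refine ⟨((t + δ) / l ^ 2, l⁻¹ • x), ?_⟩
    rw [mem_preimage, stAffine_apply, zero_add, smul_inv_smul₀ hl0.ne',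
      mul_div_cancel₀ _ (pow_pos hl0 2).ne', show -δ + (t + δ) = t by ring]
    exact hz
  · rintro ⟨s, y⟩ hz
    have h1 : -δ + l ^ 2 * s ≤ s₁ := (hU₀sub hz).1
    refine ⟨?_, mem_univ _⟩
    by_contra hs
    have : 0 ≤ l ^ 2 * s := mul_nonneg (pow_pos hl0 2).le (not_lt.1 hs)
    simp only [mem_Iio] at *
    linarith
  · rintro ⟨s, y⟩ hz
    have h1 : -δ + l ^ 2 * s ≤ s₁ := (hU₀sub hz).1
    have hs0 : -δ + l ^ 2 * s < 0 := h1.trans_lt hs₁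
    have hs : s < 0 := by
      by_contra hs
      have : 0 ≤ l ^ 2 * s := mul_nonneg (pow_pos hl0 2).le (not_lt.1 hs)
      linarith
    have hqd : DifferentiableAt ℝ (stPull (l ^ 2) l (-δ) 0 q s) y :=
      differentiable_stPull_slice ((hcl.contDiff_pressure hs0).differentiable (by simp)) y
    have hg : gradient (q' s) y = (l ^ 2 * l) • gradient (q (-δ + l ^ 2 * s)) (0 + l • y) := by
      rw [show q' s = fun z => (l ^ 2) • stPull (l ^ 2) l (-δ) 0 q s z from rfl,
        gradient_const_smul hqd, gradient_stPull, smul_smul]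
    show ⟪curl (v s) y, gradient (q' s) y⟫ = 0
    rw [hcurlv hs, hg, inner_smul_left, inner_smul_right]
    have := hU₀ _ hz
    rw [stAffine_apply] at this
    simp only [this, mul_zero]

end Summit.NavierStokesRegularity.NavierStokesRegularity.Theorems.TubeAlternative.AnalyticPropagation
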